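import Literature.IUT.HodgeArakelov.PlusMinusTowerStableCurveBridge
import Literature.IUT.HodgeTheaters.TemperedCoveringsCor23LevelsSub
import Literature.IUT.HodgeArakelov.PlusMinusTowerNonVacuity
import HarnessLib

/-!
# [IUTchII] Def 2.3 (i) / B13: the agreement structure `PlusMinusTower.StableCurveAgreement` — NON-VACUITY and the exact constraint it puts on `(W, C)`

S. Mochizuki, *Inter-universal Teichmüller Theory II*, kurims manuscript (Dec. 2020), §2, Def 2.3 (i)(ii) pp. 67–68
(«`Π^±_v := Π^tp_{X_v}`, `Π̂^±_v := Π̂_{X_v}`»; «cuspidal inertia groups … [cf. [AbsTopI], Lemma 4.5]») and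
*Inter-universal Teichmüller Theory I* (May 2020), §2 p. 46 (the data `Π^tp_X ↪ Π̂_X`, cusps `x`, inertia groups
`I_x ⊆ Δ^tp_X`) [cite: Mochizuki2012, II Def 2.3 (i)(ii) pp.67–68; I §2 p.46].  abc-iut cell, L6 BY-NAME queue,
§F v1.18p «NV-L6 WAVE», census row «PlusMinusTower.StableCurveAgreement» (HOME/staging/w5/w5-d114/
INHABITATION-CENSUS-L6-v3.md §A: 0 producers), seat abc-iut-w5-d132 (gen 2).  PROOF-ONLY: every witness is built
INSIDE a theorem term; no `def`, no `instance`, no `structure`.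

abc-iut-L6-t7's `PlusMinusTower.StableCurveAgreement W C D` (`PlusMinusTowerStableCurveBridge.lean`, MERGE-MAP B13) is
the HYPOTHESIS STRUCTURE through which the whole [IUTchII] Cor 2.4 (i) discharge chain reads abc-iut-L5-t1's [IUTchI]
§2 data: an abstract-group isomorphism `eHat : Π̂^±_v ⥲ Π̂_{X_v}` carrying `Π^±_v` onto `ι(Π^tp_{X_v})`
(`map_piPM`), `Δ̂^±_v` onto `Δ̂_{X_v}` (`mem_ker_iff`) and the `Π^±_v`-cuspidal inertia groups of `C` onto the
`Π^tp_{X_v}`-conjugates of the `I_x` (`inertia_iff`).  This file answers «is it satisfiable, and what does it demand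
of `(W, C)`?»:

* NECESSITY (`le_inf_ker_of_isCuspidalInertia`, `conj_isCuspidalInertia`): under ANY agreement the
  `Π^±_v`-cuspidal inertia groups of `C` lie in `Π^±_v ∩ Δ̂^cor_v` (they are GEOMETRIC) and are stable under
  `Π^±_v`-conjugation — the two printed properties of cuspidal inertia groups (Def 2.3 (ii): «`Π_⊇`-conjugates»;
  [IUTchI] §2: `I_x ⊆ Δ^tp_X`).
* SUFFICIENCY (`isCuspidalInertia_iff_conj_image`, `exists_agreement_of_conj_invariant`; the variant with the
  natural subspace topologies is the companion `StableCurveAgreementNonVacuitySubspace.lean`): for EVERY tower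
  `W` and EVERY `C` with exactly those two properties an L5 datum `D : StableCurveTemperedData` BUILT FROM `W`
  ITSELF (`Π̂_{X_v} := Π̂^±_v`, `Π^tp_{X_v} := Π^±_v`,
  `G_k := G_v` through `aug`, the `Δ`'s the kernels, special-fibre groups := the `Δ`'s themselves with `ℍ := 𝔾`,
  `Σ = Σ̂ := {l}`, cusps := the `Π^±_v`-cuspidal inertia groups of `C` with `I_x := x`, no points, `eHat := id`)
  carries an agreement — here with NO side condition, the `Π̂`-side copies being given the indiscrete topology
  (the agreement structure mentions no topology; the companion file uses the natural subspace topologies under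
  two side conditions, `Π̂^±_v` compact and `Δ̂^±_v` closed).  So (`nonempty_agreement_iff`)
  «`∃ D, Nonempty (StableCurveAgreement W C D)`» ⟺ «cuspidal inertia groups are geometric and form
  `Π^±_v`-conjugacy classes»: B13 constrains `(W, C)` by EXACTLY the printed
  properties — GENUINE RELATIVE TO `(W, C)`; degenerate only in that the special fibre of the witness `D` is the
  whole `Δ` (one «component» `ℍ = 𝔾`), which the agreement does not see.
* COROLLARIES: `not_nonempty_of_all_cuspidal` — the DEGENERATE cuspidal datum of p419147 («every subgroup of
  `Π^±_v` is cuspidal») admits NO agreement with any `D` as soon as `G_v` is nontrivial on `Π^±_v` (the agreement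
  is contentful); `exists_agreement_cuspless` — the cuspless `C` admits one over every tower.
* ABSOLUTE (`nonempty_degenerate`, honest label DEGENERATE): over abc-iut-w5-d063's degenerate stack
  (`PlusMinusTower.nonempty_degenerate`, p420440) the cuspless `C` and the record built from the tower carry an
  agreement — the interface IS inhabited in the tree (consistency only: no cusps, trivial Galois action, junk
  `Π̂`-side topologies).
Nothing of the series is asserted; consistency ≠ endorsement; no side taken on [IUTchIII] Cor 3.12.
-/

namespace Literature.IUT.HodgeArakelov

open Literature.IUT.HodgeTheaters
open scoped Pointwise

universe u

variable {S : BadPlaceSetting.{u}} {P : TopGroup.{u}} {T : TemperedCoverings S P}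

namespace PlusMinusTower

namespace StableCurveAgreement

variable {W : PlusMinusTower T} {C : CuspidalInertiaData W} {D : StableCurveTemperedData.{u}}

/-! ### Necessity: what an agreement forces on the cuspidal-inertia datum `C` -/

/-- **IUTchII:Def2.3(i)(ii)** (kurims pp.67–68) Under an agreement every `Π^±_v`-cuspidal inertia group is
GEOMETRIC: it lies in `Π^±_v ∩ Δ̂^cor_v` (because it is carried onto a `Π^tp_{X_v}`-conjugate of some
`I_x ⊆ Δ^tp_{X_v}`, [IUTchI] §2 p.46, and `Δ̂^±_v ↦ Δ̂_{X_v}`). PROVED. [cite: Mochizuki2012, II Def 2.3 (i) p.67] -/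
theorem le_inf_ker_of_isCuspidalInertia (A : StableCurveAgreement W C D) {I : Subgroup W.Corhat}
    (hI : C.IsCuspidalInertia W.piPM I) : I ≤ W.piPM ⊓ W.aug.ker := by
  obtain ⟨hle, x, t, hIx⟩ := (A.inertia_iff I).mp hI
  refine le_inf hle fun i hi => ?_
  have hipm : i ∈ W.pmHat := W.emb_le_pmHat (hle hi)
  -- `eHat i` lies in the image of `t I_x t⁻¹ ⊆ Δ^tp_{X_v}`, hence in `Δ̂_{X_v}`
  have hmem : A.eHat ⟨i, hipm⟩ ∈ (MulAut.conj t • (D.inertiaTp x).map D.DeltaTp.subtype).map D.ιX := by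
    rw [← hIx]
    exact ⟨⟨i, hipm⟩, Subgroup.mem_subgroupOf.mpr hi, rfl⟩
  obtain ⟨y, hy, hyi⟩ := hmem
  rw [SetLike.mem_coe, Subgroup.mem_pointwise_smul_iff_inv_smul_mem] at hy
  obtain ⟨d, -, hd⟩ := hy
  -- so `y = t d t⁻¹ ∈ Δ^tp_{X_v}` (a normal subgroup)
  have hyΔ : y ∈ D.DeltaTp := by
    have hd' : (d : D.PiTp) = t⁻¹ * y * t := by
      simpa [MulAut.smul_def, mul_assoc] using hd
    have : y = t * (d : D.PiTp) * t⁻¹ := by rw [hd']; group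
    rw [this]
    exact (MonoidHom.normal_ker D.prTp).conj_mem _ d.2 _
  have hker : A.eHat ⟨i, hipm⟩ ∈ D.DeltaHat := by
    rw [← hyi, MonoidHom.mem_ker, D.prHat_ιX]
    exact hyΔ
  exact (A.mem_ker_iff ⟨i, hipm⟩).mpr hker

/-- **IUTchII:Def2.3(ii)** (kurims p.68) Under an agreement the `Π^±_v`-cuspidal inertia groups form a union of
`Π^±_v`-CONJUGACY CLASSES («the `Π_⊇`-conjugates of …»): `I` cuspidal and `t' ∈ Π^±_v` give `t' I t'⁻¹` cuspidal
(its image is the `Π^tp_{X_v}`-conjugate by `ι⁻¹(eHat t') · t` of the same `I_x`). PROVED.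
[cite: Mochizuki2012, II Def 2.3 (ii) p.68] -/
theorem conj_isCuspidalInertia (A : StableCurveAgreement W C D) {I : Subgroup W.Corhat}
    (hI : C.IsCuspidalInertia W.piPM I) {t' : W.Corhat} (ht' : t' ∈ W.piPM) :
    C.IsCuspidalInertia W.piPM (MulAut.conj t' • I) := by
  obtain ⟨hle, x, t, hIx⟩ := (A.inertia_iff I).mp hI
  have ht'pm : t' ∈ W.pmHat := W.emb_le_pmHat ht'
  obtain ⟨s, hs⟩ := (A.mem_piPM_iff ⟨t', ht'pm⟩).mp ht'
  refine (A.inertia_iff _).mpr ⟨?_, x, s * t, ?_⟩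
  · intro y hy
    rw [Subgroup.mem_pointwise_smul_iff_inv_smul_mem] at hy
    have : y = t' * (t'⁻¹ * y * t') * t'⁻¹ := by group
    rw [this]
    exact W.piPM.mul_mem (W.piPM.mul_mem ht' (by simpa [MulAut.smul_def, mul_assoc] using hle hy))
      (W.piPM.inv_mem ht')
  · rw [map_subgroupOf_conj A.eHat I ht'pm, hIx, ← hs, StableCurveTemperedData.conj_smul_map_ιX, smul_smul, ← map_mul]

/-- **IUTchII:Def2.3(i)(ii)** (kurims pp.67–68) Consequently the DEGENERATE cuspidal datum «every subgroup of `Π^±_v`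
is cuspidal» (the `nonempty_degenerate` witness of p419147) admits NO agreement with any [IUTchI] §2 datum as soon
as `G_v` is nontrivial on `Π^±_v` — the agreement structure is contentful. PROVED.
[cite: Mochizuki2012, II Def 2.3 (i)(ii) pp.67–68] -/
theorem not_nonempty_of_all_cuspidal (hall : ∀ I : Subgroup W.Corhat, I ≤ W.piPM → C.IsCuspidalInertia W.piPM I)
    (hG : ∃ g ∈ W.piPM, W.aug g ≠ 1) : ¬ Nonempty (StableCurveAgreement W C D) := by
  rintro ⟨A⟩
  obtain ⟨g, hg, hg1⟩ := hG
  exact hg1 ((A.le_inf_ker_of_isCuspidalInertia (hall W.piPM le_rfl) hg).2)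

end StableCurveAgreement

/-! ### Sufficiency: every `(W, C)` with geometric, conjugation-stable cuspidal inertia groups admits an agreement -/

namespace StableCurveAgreement

/-- **IUTchII:Def2.3(ii)** (kurims p.68) The CORE of the sufficiency direction, purely group-theoretic: if the
`Π^±_v`-cuspidal inertia groups of `C` are geometric and `Π^±_v`-conjugation-stable, then «`I` is cuspidal» iff
«`I ⊆ Π^±_v` and, inside `Π̂^±_v`, `I` is a `Π^±_v`-conjugate of (the geometric part of) some cuspidal `I₀`» — the
`inertia_iff` clause of the agreement for the [IUTchI] §2 datum built from `W` (`Π̂_{X_v} := Π̂^±_v`,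
`Π^tp_{X_v} := Π^±_v`, `Δ^tp := Π^±_v ∩ Δ̂^cor_v`, `I_x := x`, `eHat := id`). PROVED. [cite: Mochizuki2012, II Def 2.3 (ii) p.68] -/
theorem isCuspidalInertia_iff_conj_image (W : PlusMinusTower T) (C : CuspidalInertiaData W)
    (hgeom : ∀ I : Subgroup W.Corhat, C.IsCuspidalInertia W.piPM I → I ≤ W.aug.ker)
    (hconj : ∀ I : Subgroup W.Corhat, C.IsCuspidalInertia W.piPM I →
      ∀ t ∈ W.piPM, C.IsCuspidalInertia W.piPM (MulAut.conj t • I))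
    (I : Subgroup W.Corhat) :
    C.IsCuspidalInertia W.piPM I ↔ I ≤ W.piPM ∧
      ∃ (x : {I₀ : Subgroup W.Corhat // C.IsCuspidalInertia W.piPM I₀})
        (t : ↥(W.piPM.subgroupOf W.pmHat)),
        Subgroup.map (MulEquiv.refl W.pmHat).toMonoidHom (I.subgroupOf W.pmHat) =
          Subgroup.map (W.piPM.subgroupOf W.pmHat).subtype (MulAut.conj t •
            Subgroup.map ((W.aug.comp W.pmHat.subtype).comp (W.piPM.subgroupOf W.pmHat).subtype).ker.subtype
              (x.1.comap (W.pmHat.subtype.comp ((W.piPM.subgroupOf W.pmHat).subtype.comp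
                ((W.aug.comp W.pmHat.subtype).comp (W.piPM.subgroupOf W.pmHat).subtype).ker.subtype)))) := by
  -- local names for the pieces of the datum built from `W`
  let prHat : W.pmHat →* S.Gk := W.aug.comp W.pmHat.subtype
  let Q : Subgroup W.pmHat := W.piPM.subgroupOf W.pmHat
  let prTp : Q →* S.Gk := prHat.comp Q.subtype
  let toCor : prTp.ker →* W.Corhat := W.pmHat.subtype.comp (Q.subtype.comp prTp.ker.subtype)
  let inertiaTp : {I₀ : Subgroup W.Corhat // C.IsCuspidalInertia W.piPM I₀} → Subgroup prTp.ker :=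
    fun x => x.1.comap toCor
  change C.IsCuspidalInertia W.piPM I ↔ I ≤ W.piPM ∧
    ∃ (x : {I₀ : Subgroup W.Corhat // C.IsCuspidalInertia W.piPM I₀}) (t : Q),
      Subgroup.map (MulEquiv.refl W.pmHat).toMonoidHom (I.subgroupOf W.pmHat) =
        Subgroup.map Q.subtype (MulAut.conj t • Subgroup.map prTp.ker.subtype (inertiaTp x))
  constructor
  · -- a cuspidal `I` is carried onto its own (trivial) `Π^tp_{X_v}`-conjugate
    intro hI
    have hle : I ≤ W.piPM := C.le_of_isCuspidalInertia hI
    refine ⟨hle, ⟨I, hI⟩, 1, ?_⟩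
    rw [map_one, one_smul]
    ext h
    constructor
    · rintro ⟨q, hq, rfl⟩
      have hqI : (q : W.Corhat) ∈ I := Subgroup.mem_subgroupOf.mp hq
      have hqQ : q ∈ Q := Subgroup.mem_subgroupOf.mpr (hle hqI)
      have hqker : (⟨q, hqQ⟩ : Q) ∈ prTp.ker := by
        rw [MonoidHom.mem_ker]
        exact hgeom I hI hqI
      exact ⟨⟨q, hqQ⟩, ⟨⟨⟨q, hqQ⟩, hqker⟩, Subgroup.mem_comap.mpr hqI, rfl⟩, rfl⟩
    · rintro ⟨_, ⟨d, hd, rfl⟩, rfl⟩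
      exact ⟨((d : Q) : W.pmHat), Subgroup.mem_subgroupOf.mpr (Subgroup.mem_comap.mp hd), rfl⟩
  · -- a subgroup of `Π^±_v` carried onto a `Π^tp_{X_v}`-conjugate of a cusp's inertia group IS that conjugate
    rintro ⟨hle, ⟨I₀, hI₀⟩, t, hIt⟩
    have ht : ((t : W.pmHat) : W.Corhat) ∈ W.piPM := Subgroup.mem_subgroupOf.mp t.2
    have key : I = MulAut.conj ((t : W.pmHat) : W.Corhat) • I₀ := by
      have hI₀le : I₀ ≤ W.piPM := C.le_of_isCuspidalInertia hI₀
      ext i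
      rw [Subgroup.mem_pointwise_smul_iff_inv_smul_mem]
      constructor
      · intro hi
        have hipm : i ∈ W.pmHat := W.emb_le_pmHat (hle hi)
        have h1 : (MulEquiv.refl W.pmHat).toMonoidHom ⟨i, hipm⟩ ∈
            Subgroup.map (MulEquiv.refl W.pmHat).toMonoidHom (I.subgroupOf W.pmHat) :=
          ⟨⟨i, hipm⟩, Subgroup.mem_subgroupOf.mpr hi, rfl⟩
        rw [hIt] at h1
        obtain ⟨y, hy, hyi⟩ := h1
        rw [SetLike.mem_coe, Subgroup.mem_pointwise_smul_iff_inv_smul_mem] at hy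
        obtain ⟨d, hd, hdy⟩ := hy
        have hdI₀ : (((d : Q) : W.pmHat) : W.Corhat) ∈ I₀ := Subgroup.mem_comap.mp hd
        -- `i = t d t⁻¹` in `Π̂^cor_v`
        have hi_eq : i = ((t : W.pmHat) : W.Corhat) * (((d : Q) : W.pmHat) : W.Corhat) *
            ((t : W.pmHat) : W.Corhat)⁻¹ := by
          have hval : (((Q.subtype y) : W.pmHat) : W.Corhat) = i :=
            congrArg (fun z : W.pmHat => (z : W.Corhat)) hyi
          have hdy' : (((d : Q) : W.pmHat) : W.Corhat) =
              ((t : W.pmHat) : W.Corhat)⁻¹ * ((y : W.pmHat) : W.Corhat) * ((t : W.pmHat) : W.Corhat) := by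
            have hQ : (d : Q) = t⁻¹ * y * t := by
              simpa [MulAut.smul_def, mul_assoc] using hdy
            rw [hQ]
            rfl
          have hy' : (((Q.subtype y) : W.pmHat) : W.Corhat) = ((y : W.pmHat) : W.Corhat) := rfl
          rw [← hval, hy', hdy']
          group
        rw [hi_eq]
        simpa [MulAut.smul_def, mul_assoc] using hdI₀
      · intro hi
        -- `t⁻¹ i t ∈ I₀`, so `i = t (t⁻¹ i t) t⁻¹` lies in the image
        have hmem : ((t : W.pmHat) : W.Corhat)⁻¹ * i * ((t : W.pmHat) : W.Corhat) ∈ I₀ := by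
          simpa [MulAut.smul_def, mul_assoc] using hi
        have hjpm : ((t : W.pmHat) : W.Corhat)⁻¹ * i * ((t : W.pmHat) : W.Corhat) ∈ W.piPM :=
          (C.le_of_isCuspidalInertia hI₀) hmem
        set j : W.Corhat := ((t : W.pmHat) : W.Corhat)⁻¹ * i * ((t : W.pmHat) : W.Corhat) with hj
        have hjQ : (⟨j, W.emb_le_pmHat hjpm⟩ : W.pmHat) ∈ Q := Subgroup.mem_subgroupOf.mpr hjpm
        have hjker : (⟨⟨j, W.emb_le_pmHat hjpm⟩, hjQ⟩ : Q) ∈ prTp.ker := by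
          rw [MonoidHom.mem_ker]
          exact hgeom I₀ hI₀ hmem
        have hipm : i ∈ W.pmHat := by
          have : i = ((t : W.pmHat) : W.Corhat) * j * ((t : W.pmHat) : W.Corhat)⁻¹ := by
            rw [hj]; group
          rw [this]
          exact W.pmHat.mul_mem (W.pmHat.mul_mem (t : W.pmHat).2 (W.emb_le_pmHat hjpm))
            (W.pmHat.inv_mem (t : W.pmHat).2)
        have h2 : (⟨i, hipm⟩ : W.pmHat) ∈
            Subgroup.map Q.subtype (MulAut.conj t • Subgroup.map prTp.ker.subtype (inertiaTp ⟨I₀, hI₀⟩)) := by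
          refine ⟨t * ⟨⟨j, W.emb_le_pmHat hjpm⟩, hjQ⟩ * t⁻¹, ?_, ?_⟩
          · rw [SetLike.mem_coe, Subgroup.mem_pointwise_smul_iff_inv_smul_mem]
            refine ⟨⟨⟨⟨j, W.emb_le_pmHat hjpm⟩, hjQ⟩, hjker⟩, Subgroup.mem_comap.mpr hmem, ?_⟩
            simp [MulAut.smul_def, mul_assoc]
          · apply Subtype.ext
            change ((t : W.pmHat) : W.Corhat) * j * ((t : W.pmHat) : W.Corhat)⁻¹ = i
            rw [hj]; group
        rw [← hIt] at h2
        obtain ⟨q, hq, hqi⟩ := h2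
        have : (q : W.Corhat) = i := congrArg (fun z : W.pmHat => (z : W.Corhat)) hqi
        rw [← this]
        exact Subgroup.mem_subgroupOf.mp hq
    rw [key]
    exact hconj I₀ hI₀ _ ht

/-- `G_v` is reached from `Π_v ⊆ Π^±_v` through the tower's augmentation (`aug_compat` + surjectivity of
`Π^tp_{X̲̲_v} ↠ G_v` in the setting). [cite: Mochizuki2012, II Def 2.3 (i) p.67] -/
theorem aug_surjective_on_piPM (W : PlusMinusTower T) (g : S.Gk) : ∃ y ∈ W.piPM, W.aug y = g := by
  obtain ⟨e, he⟩ := W.aug_compat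
  obtain ⟨z, rfl⟩ := S.aug_surjective g
  refine ⟨W.emb (T.incl (e.symm z)), ⟨T.incl (e.symm z), rfl⟩, ?_⟩
  rw [he, ContinuousMulEquiv.apply_symm_apply]

/-! ### Sufficiency (topology-free form), the equivalence, and the ABSOLUTE witness -/

/-- Any type with the indiscrete topology is compact (every open cover contains `univ` or covers `∅`). [folklore] -/
private theorem compactSpace_of_top (X : Type u) : @CompactSpace X ⊤ := by
  letI : TopologicalSpace X := ⊤
  refine ⟨isCompact_of_finite_subcover fun {ι} U hU hcover => ?_⟩
  by_cases h : (Set.univ : Set X).Nonempty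
  · obtain ⟨x, -⟩ := h
    obtain ⟨i, hi⟩ := Set.mem_iUnion.mp (hcover (Set.mem_univ x))
    have hUi : U i = Set.univ :=
      ((TopologicalSpace.isOpen_top_iff _).mp (hU i)).resolve_left (Set.nonempty_iff_ne_empty.mp ⟨x, hi⟩)
    refine ⟨{i}, ?_⟩
    rw [Finset.set_biUnion_singleton, hUi]
  · rw [Set.not_nonempty_iff_eq_empty.mp h]
    exact ⟨∅, Set.empty_subset _⟩

/-- Any group with the indiscrete topology is a topological group. [folklore] -/
private theorem isTopologicalGroup_of_top (G : Type u) [Group G] : @IsTopologicalGroup G ⊤ _ := by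
  letI : TopologicalSpace G := ⊤
  exact { continuous_mul := continuous_top, continuous_inv := continuous_top }

/-- **IUTchII:Def2.3(i)** (kurims p.67) **SUFFICIENCY / NON-VACUITY, GENUINE RELATIVE TO `(W, C)` (topology-free form)**: the
agreement structure mentions no topology, so the [IUTchI] §2 record can be filled with the INDISCRETE topology on the copies
`Π̂_{X_v} := Π̂^±_v`, `Π̂_𝔾 := Δ̂^±_v` (honest label: the `Π̂`-side topologies of this witness are junk; every
group-theoretic datum is `W`'s own).  Hence for EVERY tower `W` and every `C` with geometric,
`Π^±_v`-conjugation-stable cuspidal inertia groups there is an agreement, with no side condition at all. PROVED.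
[cite: Mochizuki2012, II Def 2.3 (i)(ii) pp.67–68] -/
theorem exists_agreement_of_conj_invariant (W : PlusMinusTower T) (C : CuspidalInertiaData W)
    (hgeom : ∀ I : Subgroup W.Corhat, C.IsCuspidalInertia W.piPM I → I ≤ W.aug.ker)
    (hconj : ∀ I : Subgroup W.Corhat, C.IsCuspidalInertia W.piPM I →
      ∀ t ∈ W.piPM, C.IsCuspidalInertia W.piPM (MulAut.conj t • I)) :
    ∃ D : StableCurveTemperedData.{u}, Nonempty (StableCurveAgreement W C D) := by
  classical
  let prHat : W.pmHat →* S.Gk := W.aug.comp W.pmHat.subtype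
  let Q : Subgroup W.pmHat := W.piPM.subgroupOf W.pmHat
  let prTp : Q →* S.Gk := prHat.comp Q.subtype
  let ιΔ : prTp.ker →* prHat.ker := (Q.subtype.comp prTp.ker.subtype).codRestrict prHat.ker fun d => d.2
  have hιΔ_inj : Function.Injective ιΔ := fun a b h =>
    Subtype.ext (Subtype.ext (congrArg (fun z : prHat.ker => (z : W.pmHat)) h))
  let Cusp : Type u := {I : Subgroup W.Corhat // C.IsCuspidalInertia W.piPM I}
  let toCor : prTp.ker →* W.Corhat := W.pmHat.subtype.comp (Q.subtype.comp prTp.ker.subtype)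
  let inertiaTp : Cusp → Subgroup prTp.ker := fun x => x.1.comap toCor
  let D : StableCurveTemperedData.{u} :=
    { graph :=
        { Sigma := {S.l}
          SigmaHat := {S.l}
          sigma_subset := subset_rfl
          sigma_nonempty := ⟨S.l, rfl⟩
          sigmaHat_prime := by
            intro q hq
            rw [Set.mem_singleton_iff] at hq
            subst hq
            exact S.l_prime
          Tp := prTp.ker
          Hat := prHat.ker
          hatTop := ⊤
          hatTopGroup := isTopologicalGroup_of_top _
          hatCompact := compactSpace_of_top _
          ι := ιΔ
          ι_continuous := continuous_top
          ι_injective := hιΔ_inj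
          TpH := ⊤
          HatH := ⊤
          tpH_le := le_top }
      p := S.p
      p_notMem := by
        change S.p ∉ ({S.l} : Set ℕ)
        rw [Set.mem_singleton_iff]
        exact S.p_ne_l
      PiTp := Q
      PiHat := W.pmHat
      piHatTop := ⊤
      piHatTopGroup := isTopologicalGroup_of_top _
      piHatCompact := compactSpace_of_top _
      Gk := S.Gk
      ιX := Q.subtype
      ιX_continuous := continuous_top
      ιX_injective := Subtype.val_injective
      prTp := prTp
      prHat := prHat
      prTp_surjective := by
        intro g
        obtain ⟨y, hy, hyg⟩ := aug_surjective_on_piPM W g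
        exact ⟨⟨⟨y, W.emb_le_pmHat hy⟩, Subgroup.mem_subgroupOf.mpr hy⟩, hyg⟩
      prHat_comp := rfl
      ρTp := MonoidHom.id _
      ρHat := MonoidHom.id _
      ρTp_surjective := Function.surjective_id
      ρHat_surjective := Function.surjective_id
      ρ_comp := fun d => rfl
      Cusp := Cusp
      inertiaTp := inertiaTp
      cuspMeetsH := fun _ => True
      Pt := PEmpty.{u + 1}
      decompTp := fun e => nomatch e }
  refine ⟨D, ⟨{ eHat := MulEquiv.refl W.pmHat, map_piPM := ?_, mem_ker_iff := (fun g => Iff.rfl),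
                 inertia_iff := fun I => isCuspidalInertia_iff_conj_image W C hgeom hconj I }⟩⟩
  change Subgroup.map (MulEquiv.refl W.pmHat).toMonoidHom Q = Q.subtype.range
  rw [Subgroup.range_subtype]
  ext q
  simp

/-- **IUTchII:Def2.3(i)(ii)** (kurims pp.67–68) **The exact constraint, as an equivalence.**  Over ANY tower
`W`, a cuspidal-inertia datum `C` admits an agreement with SOME [IUTchI] §2 datum
iff its `Π^±_v`-cuspidal inertia groups are geometric (`⊆ Δ̂^cor_v`) and stable under `Π^±_v`-conjugation. PROVED
(necessity for any `D`; sufficiency by the topology-free construction, no side condition). [cite: Mochizuki2012, II Def 2.3 (i)(ii) pp.67–68] -/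
theorem nonempty_agreement_iff (W : PlusMinusTower T) (C : CuspidalInertiaData W) :
    (∃ D : StableCurveTemperedData.{u}, Nonempty (StableCurveAgreement W C D)) ↔
      ((∀ I : Subgroup W.Corhat, C.IsCuspidalInertia W.piPM I → I ≤ W.aug.ker) ∧
        ∀ I : Subgroup W.Corhat, C.IsCuspidalInertia W.piPM I →
          ∀ t ∈ W.piPM, C.IsCuspidalInertia W.piPM (MulAut.conj t • I)) := by
  constructor
  · rintro ⟨D, ⟨A⟩⟩
    exact ⟨fun I hI => (A.le_inf_ker_of_isCuspidalInertia hI).trans inf_le_right,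
      fun I hI t ht => A.conj_isCuspidalInertia hI ht⟩
  · rintro ⟨hgeom, hconj⟩
    exact exists_agreement_of_conj_invariant W C hgeom hconj

/-- **IUTchII:Def2.3(i)** (kurims p.67) CUSPLESS witness (honest label: degenerate on the cusp axis): over every
tower, the cuspidal-inertia datum with NO cuspidal inertia groups admits an agreement — so
`StableCurveAgreement W C D` is inhabited for SOME `(C, D)` over EVERY `W`.
[cite: Mochizuki2012, II Def 2.3 (i) p.67] -/
theorem exists_agreement_cuspless (W : PlusMinusTower T) :
    ∃ (C : CuspidalInertiaData W) (D : StableCurveTemperedData.{u}), Nonempty (StableCurveAgreement W C D) :=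
  ⟨{ IsCuspidalInertia := fun _ _ => False, le_of_isCuspidalInertia := fun h => h.elim },
    exists_agreement_of_conj_invariant W _ (fun _ h => h.elim) (fun _ h => h.elim)⟩


/-- **IUTchII:Def2.3(i)** (kurims p.67) **ABSOLUTE witness (honest label: DEGENERATE)** — NV-L6 row
«PlusMinusTower.StableCurveAgreement»: SOME `±`-tower (abc-iut-w5-d063's degenerate stack
`PlusMinusTower.nonempty_degenerate`, p420440: trivial tempered/Galois groups, finite ambient group), the CUSPLESS
cuspidal-inertia datum over it and the [IUTchI] §2 record built from the tower carry an agreement: the hypothesis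
structure `StableCurveAgreement` is INHABITED in the tree.  degenerate: no cusps, trivial Galois action, junk
`Π̂`-side topologies — consistency of the interface only; the GENUINE content is the relative
`nonempty_agreement_iff`. [cite: Mochizuki2012, II Def 2.3 (i) p.67] -/
theorem nonempty_degenerate :
    ∃ (S₀ : BadPlaceSetting.{0}) (P₀ : TopGroup.{0}) (T₀ : TemperedCoverings S₀ P₀) (W : PlusMinusTower T₀)
      (C : CuspidalInertiaData W) (D : StableCurveTemperedData.{0}), Nonempty (StableCurveAgreement W C D) := by
  obtain ⟨S₀, P₀, T₀, ⟨W⟩⟩ := PlusMinusTower.nonempty_degenerate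
  obtain ⟨D, hD⟩ := exists_agreement_of_conj_invariant W
    { IsCuspidalInertia := fun _ _ => False, le_of_isCuspidalInertia := fun h => h.elim }
    (fun _ h => h.elim) (fun _ h => h.elim)
  exact ⟨S₀, P₀, T₀, W, _, D, hD⟩

end StableCurveAgreement

end PlusMinusTower

end Literature.IUT.HodgeArakelov
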